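import Literature.NumberTheory.PAdicHodge.RankOneEmbeddingEvaluation
import Literature.NumberTheory.PAdicHodge.DeRhamRankOneEmbeddingPeriods
import Literature.NumberTheory.PAdicHodge.TateTwistInvariantsRelative
import Literature.NumberTheory.PAdicHodge.BdRDevissageInputs
import HarnessLib

/-!
# Labelled Hodge–Tate weights of a de Rham character from ONE `ℂ_F`-period (rank one)

Let `F/ℚ_p` be a `p`-adic field, `𝔅 = B_dR(F)` (`bdRPeriodRingData hp`), `E/ℚ_p` finite containing
the `[F:ℚ_p]` embeddings of `F`, `rE : Γ_F → GL₁(E)` a `B_dR`-admissible (de Rham) character,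
`τ : F → E` a label and `j : E → F̄` a `ℚ_p`-embedding OVER `τ` (`j ∘ τ = (F ⊆ F̄)`).

**Main theorem** (`labelledHodgeTateWeights_eq_singleton_of_theta_period`).  If `y ∈ ℂ_F ∖ 0` and
`n ∈ ℤ` satisfy `y = j(det rE(σ)) · χ(σ)^n · σ(y)` for all `σ ∈ Γ_F` fixing pointwise a finite
extension `M/F` inside `F̄`, then `HT_τ(rE) = {n}`.  (Convention check: `rE = χ_cyc`, `y = 1`,
`n = -1`; the tree's `HT(χ_cyc) = {-1}`.)  So ONE `ℂ_F`-period on ONE finite-index subgroup pins the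
`τ`-labelled weight — the uniqueness half of Tate's theory of Hodge–Tate characters
(Serre, *Abelian ℓ-adic representations*, III.A.5; Fontaine, Exp. III §1.5), run inside the single
field `ℂ_F` with the RELATIVE vanishing `H⁰(Gal(F̄/M'), ℂ_F(χ^j)) = 0`, `j ≠ 0`
(`CompletedAlgClosure.eq_zero_of_forall_fixing_smul_eq_cyclotomicCharacter_zpow`).

Route.  `D_τ(rE)` is an `E`-line (`finrank_labelD_eq_of_isAdmissible`), so `HT_τ = {w}` with
`Fil^w D_τ = D_τ`, `Fil^{w+1} D_τ = 0`; for a generator `x`, the evaluation `z = ev_j x ∈ B_dR`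
(`RankOneEmbeddingEvaluation`) lies in `Fil^w ∖ Fil^{w+1}` (the filtration is read at the embeddings
over `τ`, which form one `Γ_F`-orbit, and `ev_{j'} x = 0` off `τ`) and satisfies
`z = ι(j(det rE σ)) σ(z)` on `Stab(j)`; the `θ`-reduction WITH EXPONENT
(`exists_theta_period_of_mem_fil_not_mem`: `z = u^w · unit`) produces a `ℂ_F`-period with exponent
`w` on `Stab(j)`; the quotient of the two periods is a `χ^{w-n}`-semi-invariant of `Gal(F̄/M')`,
`M' = M · F(j(E))`, hence zero unless `w = n`.

## Main statements
* `exists_theta_period_of_mem_fil_not_mem`: `θ`-reduction of a rank-one `B_dR`-period keeping the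
  exponent (`z ∈ Fil^n ∖ Fil^{n+1}` ↦ exponent `n`).
* `exists_intermediateField_fixing_embedding`: a finite `M' ⊇ M` whose pointwise stabiliser fixes
  `j(E)`.
* `labelledHodgeTateWeights_eq_singleton_of_theta_period`: the main theorem.

## References
* [FontaineAsterisque223III] J.-M. Fontaine, Astérisque 223, Exp. II §1.5.4–1.5.5, Exp. III §1.5,
  Prop. 1.5.2.
* [SerreAbelianLadic1968] J.-P. Serre, *Abelian ℓ-adic representations*, Ch. III App. A.1–A.5.
* [Tate1967] J. Tate, *p-divisible groups*, §3.3 Theorem 2.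
* [Patrikis2019] S. Patrikis, *Variations on a theorem of Tate*, §2.3.1.
-/

noncomputable section

open Field ValuativeRel Matrix TensorProduct WittVector
open scoped MatrixGroups TensorProduct

namespace Literature.NumberTheory.PAdicHodge

open Literature.NumberTheory.GaloisRepresentations
open Literature.NumberTheory.GaloisRepresentations.IsNonarchimedeanLocalField
open Literature.NumberTheory.Automorphic

namespace RankOneLabelledWeights

section BdR

variable {F : Type} [Field F] [ValuativeRel F] [TopologicalSpace F] [IsNonarchimedeanLocalField F]
  [CharZero F] {p : ℕ} [Fact p.Prime] [Fact (¬ IsUnit (p : integerC F))]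
  [IsAdicComplete (Ideal.span {(p : integerC F)}) (integerC F)]
  (hp : valuation F p < 1)

-- Mathlib's own global value of `maxSynthPendingDepth` (see `PeriodRingData.rank_D_le`).
set_option maxSynthPendingDepth 3

/-! ### The `θ`-reduction with exponent -/

include hp in
/-- **`θ`-reduction of a rank-one `B_dR`-period, keeping the exponent.**  Let `φ : Γ_F → F̄`,
`Q ⊆ Γ_F`, and `z ∈ Fil^n B_dR ∖ Fil^{n+1} B_dR` with `z = ι(φ σ) · σ(z)` for `σ ∈ Q`
(`ι : F̄ ↪ B_dR⁺ ⊆ B_dR` the section of `θ`).  Then there is `y ∈ ℂ_F`, `y ≠ 0`, with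
`y = φ(σ) · χ(σ)^n · σ(y)` for all `σ ∈ Q` (`χ` the cyclotomic character through
`ℤ_p ⊆ ℚ_p → F → ℂ_F`): `z = u^n w` with `w ∈ (B_dR⁺)ˣ` (a non-unit `w` would put `z` in
`Fil^{n+1}`), `σ(u) = k_σ u`, `θ(k_σ) = χ(σ)`, `y = θ(w)`.
[cite: FontaineAsterisque223III, Exp. II §1.5.4–1.5.5] [cite: SerreAbelianLadic1968, Ch. III §A.1] -/
theorem exists_theta_period_of_mem_fil_not_mem [Algebra ℚ_[p] F] {Q : absoluteGaloisGroup F → Prop}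
    {φ : absoluteGaloisGroup F → AlgebraicClosure F} {z : FracBdR F p} {n : ℤ}
    (hzn : z ∈ (bdRPeriodRingData (F := F) (p := p) hp).fil n)
    (hzn' : z ∉ (bdRPeriodRingData (F := F) (p := p) hp).fil (n + 1))
    (hz : ∀ σ : absoluteGaloisGroup F, Q σ →
      z = ((algebraMap (BDeRhamPlus (integerC F) p) (FracBdR F p)).comp
        (algClosureToBdR hp (surjective_fontaineTheta_integerC hp))) (φ σ) * σ • z) :
    ∃ y : CompletedAlgClosure F, y ≠ 0 ∧ ∀ σ : absoluteGaloisGroup F, Q σ →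
      y = algClosureToC F (φ σ) *
        (algebraMap F (CompletedAlgClosure F)
          (LocalField.padicRingHom F p hp
            (((GaloisRep.cyclotomicCharacter F p σ : ℤ_[p]ˣ) : ℤ_[p]) : ℚ_[p]))) ^ n * σ • y := by
  classical
  have hF : Function.Surjective (fontaineTheta (integerC F) p) := surjective_fontaineTheta_integerC hp
  haveI : IsDomain (BDeRhamPlus (integerC F) p) := isDomain_bDeRhamPlus hF
  set a := algebraMap (BDeRhamPlus (integerC F) p) (FracBdR F p) with ha
  have hu0 : a uBdR ≠ 0 := by
    obtain ⟨v, hv, huv⟩ := exists_uBdR_eq_xiBdR_mul (F := F) (p := p) hF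
    rw [huv, map_mul]
    exact mul_ne_zero (algebraMap_xiBdR_ne_zero hF)
      ((map_ne_zero_iff _ algebraMap_fracBdR_injective).2 hv.ne_zero)
  -- `z = u^n · b`, `b ∈ B_dR⁺`
  obtain ⟨b, hb⟩ := (BdRTateGraded.mem_fil_iff_unif_zpow hp hF n z).1 hzn
  -- `b` is a unit, for otherwise `z ∈ Fil^{n+1}`
  have hbu : IsUnit b := by
    rw [isUnit_iff_thetaBdR_ne_zero hF]
    intro hθ
    apply hzn'
    obtain ⟨c, hc⟩ := Ideal.mem_span_singleton'.1 ((mem_ker_thetaBdR_iff b).1 hθ)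
    obtain ⟨v, hv, huv⟩ := exists_uBdR_eq_xiBdR_mul (F := F) (p := p) hF
    refine (BdRTateGraded.mem_fil_iff_unif_zpow hp hF (n + 1) z).2
      ⟨c * ((hv.unit⁻¹ : (BDeRhamPlus (integerC F) p)ˣ) : BDeRhamPlus (integerC F) p), ?_⟩
    have hvv : a ((hv.unit : (BDeRhamPlus (integerC F) p)ˣ) : BDeRhamPlus (integerC F) p) *
        a ((hv.unit⁻¹ : (BDeRhamPlus (integerC F) p)ˣ) : BDeRhamPlus (integerC F) p) = 1 := by
      rw [← map_mul, Units.mul_inv, map_one]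
    rw [hb, ← hc, zpow_add_one₀ hu0, map_mul, map_mul,
      show a uBdR = a xiBdR * a ((hv.unit : (BDeRhamPlus (integerC F) p)ˣ) : BDeRhamPlus (integerC F) p)
        by rw [IsUnit.unit_spec, huv, map_mul]]
    calc (a xiBdR * a ↑hv.unit) ^ n * (a c * a xiBdR)
        = (a xiBdR * a ↑hv.unit) ^ n * (a c * a xiBdR) * (a ↑hv.unit * a ↑hv.unit⁻¹) := by
          rw [hvv, mul_one]
      _ = (a xiBdR * a ↑hv.unit) ^ n * (a xiBdR * a ↑hv.unit) * (a c * a ↑hv.unit⁻¹) := by ring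
  obtain ⟨w, hw⟩ : ∃ w : (BDeRhamPlus (integerC F) p)ˣ, z = a uBdR ^ n * a (w : BDeRhamPlus (integerC F) p) :=
    ⟨hbu.unit, by rw [IsUnit.unit_spec]; exact hb⟩
  clear hb hbu
  refine ⟨thetaBdR (w : BDeRhamPlus (integerC F) p),
    (isUnit_iff_thetaBdR_ne_zero hF _).1 w.isUnit, fun σ hσ => ?_⟩
  -- `σ(u) = k_σ u`, `θ(k_σ) = χ(σ)`, `k_σ` a unit
  obtain ⟨kσ, hkσ, hθk⟩ := exists_galBdRPlus_uBdR_eq_mul_cyclotomic hp hF σ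
  have hkunit : IsUnit kσ := by
    rw [isUnit_iff_thetaBdR_ne_zero hF, hθk, map_ne_zero_iff _ (algebraMap F (CompletedAlgClosure F)).injective,
      map_ne_zero_iff _ (LocalField.padicRingHom F p hp).injective]
    exact PadicInt.coe_ne_zero.2 (GaloisRep.cyclotomicCharacter F p σ).ne_zero
  have hσu : σ • (a uBdR ^ n) = (a kσ * a uBdR) ^ n := by
    rw [smul_fracBdR_eq_toRingHom σ (_ ^ n), map_zpow₀, ← smul_fracBdR_eq_toRingHom, ha,
      smul_algebraMap_fracBdR, hkσ, map_mul]
  -- the relation, in `B_dR`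
  have h1 : a uBdR ^ n * a (w : BDeRhamPlus (integerC F) p) =
      a uBdR ^ n * (a (algClosureToBdR hp hF (φ σ)) * a kσ ^ n *
        a (galBdRPlus σ (w : BDeRhamPlus (integerC F) p))) := by
    have h := hz σ hσ
    rw [hw, smul_mul', hσu, smul_algebraMap_fracBdR, RingHom.comp_apply, ← ha, mul_zpow] at h
    refine h.trans ?_
    ring
  have h1' : a (w : BDeRhamPlus (integerC F) p) =
      a (algClosureToBdR hp hF (φ σ)) * a kσ ^ n * a (galBdRPlus σ (w : BDeRhamPlus (integerC F) p)) :=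
    mul_left_cancel₀ (zpow_ne_zero n hu0) h1
  -- pulled back to `B_dR⁺`
  have h2 : (w : BDeRhamPlus (integerC F) p) =
      algClosureToBdR hp hF (φ σ) * ((hkunit.unit ^ n : (BDeRhamPlus (integerC F) p)ˣ) :
        BDeRhamPlus (integerC F) p) * galBdRPlus σ (w : BDeRhamPlus (integerC F) p) := by
    apply algebraMap_fracBdR_injective (F := F) (p := p)
    rw [← ha, h1', map_mul, map_mul, ringHom_units_zpow, IsUnit.unit_spec]
  -- apply `θ`
  have h3 := congrArg thetaBdR h2
  rw [map_mul, map_mul, ringHom_units_zpow, IsUnit.unit_spec, hθk, thetaBdR_galBdRPlus,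
    thetaBdR_algClosureToBdR] at h3
  exact h3

/-! ### A finite extension whose stabiliser fixes an embedded coefficient field -/

omit [ValuativeRel F] [TopologicalSpace F] [IsNonarchimedeanLocalField F] [CharZero F]
  [Fact (¬ IsUnit (p : integerC F))] [IsAdicComplete (Ideal.span {(p : integerC F)}) (integerC F)] in
/-- **Enlarging the fixed field.**  For a finite `M/F` inside `F̄` and a `ℚ_p`-embedding `j : E → F̄`
of a finite extension `E/ℚ_p`, there is a finite `M' ⊇ M` (namely `M · F(j(E))`) such that every
`σ ∈ Γ_F` fixing `M'` pointwise fixes `M` pointwise and satisfies `σ ∘ j = j`. [folklore]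
[cite: SerreAbelianLadic1968, Ch. III §A.5 (passage to a finite extension)] -/
theorem exists_intermediateField_fixing_embedding [ValuativeRel F] [TopologicalSpace F]
    [IsNonarchimedeanLocalField F] [Algebra ℚ_[p] F]
    {E : Type} [Field E] [Algebra ℚ_[p] E] [FiniteDimensional ℚ_[p] E]
    (M : IntermediateField F (NormedAlgClosure F)) [FiniteDimensional F M]
    (j : E →ₐ[ℚ_[p]] AlgebraicClosure F) :
    ∃ M' : IntermediateField F (NormedAlgClosure F), FiniteDimensional F M' ∧
      ∀ σ : absoluteGaloisGroup F, (∀ m ∈ M', σ • m = m) →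
        (∀ m ∈ M, σ • m = m) ∧ ∀ e : E, σ • j e = j e := by
  classical
  let bE := Module.finBasis ℚ_[p] E
  let ι₀ : AlgebraicClosure F → NormedAlgClosure F := fun x => NormedAlgClosure.toAlgClosure.symm x
  let S : Finset (NormedAlgClosure F) := Finset.univ.image fun k => ι₀ (j (bE k))
  let N : IntermediateField F (NormedAlgClosure F) := IntermediateField.adjoin F (S : Set (NormedAlgClosure F))
  haveI : FiniteDimensional F N :=
    IntermediateField.finiteDimensional_adjoin fun x _ => (Algebra.IsAlgebraic.isAlgebraic (R := F) x).isIntegral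
  refine ⟨M ⊔ N, inferInstance, fun σ hσ => ⟨fun m hm => hσ m (le_sup_left (a := M) (b := N) hm), fun e => ?_⟩⟩
  -- `σ` fixes each `j(bE k)`
  have hk : ∀ k, σ • j (bE k) = j (bE k) := by
    intro k
    have hmem : ι₀ (j (bE k)) ∈ M ⊔ N :=
      (le_sup_right (a := M) (b := N)) (IntermediateField.subset_adjoin F _
        (Finset.mem_coe.2 (Finset.mem_image.2 ⟨k, Finset.mem_univ _, rfl⟩)))
    exact hσ _ hmem
  -- hence `σ` fixes `j(e)` for every `e`
  conv_lhs => rw [← bE.sum_repr e]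
  conv_rhs => rw [← bE.sum_repr e]
  rw [map_sum, Finset.smul_sum]
  refine Finset.sum_congr rfl fun k _ => ?_
  rw [map_smul, Algebra.smul_def, smul_mul', hk k,
    IsScalarTower.algebraMap_apply ℚ_[p] F (AlgebraicClosure F), smul_algebraMap]

/-! ### The main theorem -/

/-- **One `ℂ_F`-period determines the labelled weight (rank one).**  Let `rE : Γ_F → GL₁(E)` be
`B_dR`-admissible, `E ⊇` the embeddings of `F`, `τ : F → E` a label and `j : E → F̄` an embedding over
`τ`.  If `y ∈ ℂ_F ∖ 0` satisfies `y = j(det rE σ) · χ(σ)^n · σ(y)` for every `σ ∈ Γ_F` fixing a finite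
`M/F` pointwise, then `HT_τ(rE) = {n}` (for `B_dR(F) = bdRPeriodRingData hp`).  Proof in the module
docstring: `D_τ` is a line with jump `w`; a generator evaluates at `j` to `z ∈ Fil^w ∖ Fil^{w+1}`
with `z = ι(j det rE σ) σ(z)` on `Stab(j)`; `θ`-reduction gives a `ℂ_F`-period with exponent `w`;
the quotient by `y` is a `χ^{w-n}`-semi-invariant of `Gal(F̄/M·F(jE))`, so `w = n` by Tate.
[cite: SerreAbelianLadic1968, Ch. III §A.5 Thm. 2] [cite: FontaineAsterisque223III, Exp. III §1.5,
Prop. 1.5.2] [cite: Tate1967, §3.3 Theorem 2] -/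
theorem labelledHodgeTateWeights_eq_singleton_of_theta_period [Algebra ℚ_[p] F]
    [FiniteDimensional ℚ_[p] F]
    {E : Type} [Field E] [Algebra ℚ_[p] E] [FiniteDimensional ℚ_[p] E] [TopologicalSpace E]
    [IsTopologicalRing E]
    (hsplit : Fintype.card (F →ₐ[ℚ_[p]] E) = Module.finrank ℚ_[p] F)
    (rE : FramedRep (absoluteGaloisGroup F) E 1)
    (hdR : (bdRPeriodRingData (F := F) (p := p) hp).IsAdmissible
      ((FramedRep.toContinuousRep rE).restrictScalars ℚ_[p]))
    (τ : F →ₐ[ℚ_[p]] E) (j : E →ₐ[ℚ_[p]] AlgebraicClosure F)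
    (hj : ∀ a : F, j (τ a) = algebraMap F (AlgebraicClosure F) a)
    (M : IntermediateField F (NormedAlgClosure F)) [FiniteDimensional F M] {n : ℤ}
    {y : CompletedAlgClosure F} (hy0 : y ≠ 0)
    (hy : ∀ σ : absoluteGaloisGroup F, (∀ m ∈ M, σ • m = m) →
      y = algClosureToC F (j ((FramedRep.det rE σ : Eˣ) : E)) *
        (algebraMap F (CompletedAlgClosure F)
          (LocalField.padicRingHom F p hp
            (((GaloisRep.cyclotomicCharacter F p σ : ℤ_[p]ˣ) : ℤ_[p]) : ℚ_[p]))) ^ n * σ • y) :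
    (bdRPeriodRingData (F := F) (p := p) hp).labelledHodgeTateWeights (FramedRep.toContinuousRep rE)
      τ.toRingHom = {n} := by
  classical
  have hF : Function.Surjective (fontaineTheta (integerC F) p) := surjective_fontaineTheta_integerC hp
  haveI : IsDomain (BDeRhamPlus (integerC F) p) := isDomain_bDeRhamPlus hF
  haveI : Algebra.IsSeparable ℚ_[p] F := Algebra.IsSeparable.of_integral ℚ_[p] F
  set 𝔅 := bdRPeriodRingData (F := F) (p := p) hp with h𝔅
  set ρ := FramedRep.toContinuousRep rE with hρ
  -- the section `ι : F̄ → B_dR⁺ ⊆ B_dR` and its properties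
  set ιB : AlgebraicClosure F →+* 𝔅.B :=
    (algebraMap (BDeRhamPlus (integerC F) p) (FracBdR F p)).comp (algClosureToBdR hp hF) with hιB
  have hισ : ∀ (σ : absoluteGaloisGroup F) (x : AlgebraicClosure F), σ • ιB x = ιB (σ • x) :=
    smul_algClosureToFracBdR hp
  have hιa : ∀ a : F, ιB (algebraMap F (AlgebraicClosure F) a) = algebraMap F 𝔅.B a :=
    algClosureToFracBdR_algebraMap hp
  have hιq : ∀ c : ℚ_[p], algebraMap ℚ_[p] 𝔅.B c = ιB (algebraMap ℚ_[p] (AlgebraicClosure F) c) :=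
    algebraMap_padic_eq_iota 𝔅 ιB hιa
  have hιfil : ∀ x : AlgebraicClosure F, ιB x ∈ 𝔅.fil 0 := fun x => algebraMap_mem_fil_zero hp hF _
  -- Step 1: `D_τ` is an `E`-line; its filtration jumps exactly once, at `w`, and `HT_τ = {w}`
  have hB : IsField 𝔅.B := Field.toIsField (FracBdR F p)
  obtain ⟨hfinD, hrank⟩ := 𝔅.finrank_labelD_eq_of_isAdmissible hB hsplit rE hdR τ
  haveI := hfinD
  haveI hfinFil : ∀ i, FiniteDimensional E (𝔅.labelFilD ρ τ.toRingHom i) := fun i =>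
    Submodule.finiteDimensional_of_le (𝔅.labelFilD_le ρ τ.toRingHom i)
  have hdle : ∀ i, Module.finrank E (𝔅.labelFilD ρ τ.toRingHom i) ≤ 1 := fun i =>
    (Submodule.finrank_mono (𝔅.labelFilD_le ρ τ.toRingHom i)).trans hrank.le
  have hanti : Antitone fun i => Module.finrank E (𝔅.labelFilD ρ τ.toRingHom i) :=
    fun i i' hii' => Submodule.finrank_mono (𝔅.labelFilD_antitone ρ τ.toRingHom hii')
  obtain ⟨a, ha⟩ := 𝔅.exists_labelFilD_eq_labelD ρ τ.toRingHom
  obtain ⟨b, hb⟩ := 𝔅.exists_labelFilD_eq_bot ρ τ.toRingHom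
  have hda : Module.finrank E (𝔅.labelFilD ρ τ.toRingHom a) = 1 := by rw [ha, hrank]
  have hdb : Module.finrank E (𝔅.labelFilD ρ τ.toRingHom b) = 0 := by rw [hb, finrank_bot]
  have hfin : {i : ℤ | Module.finrank E (𝔅.labelFilD ρ τ.toRingHom (i + 1)) <
      Module.finrank E (𝔅.labelFilD ρ τ.toRingHom i)}.Finite := by
    refine (Set.finite_Icc (a - 1) b).subset fun i hi => ?_
    simp only [Set.mem_setOf_eq] at hi
    refine ⟨?_, ?_⟩
    · by_contra h
      have h1 : Module.finrank E (𝔅.labelFilD ρ τ.toRingHom a) ≤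
          Module.finrank E (𝔅.labelFilD ρ τ.toRingHom (i + 1)) := hanti (by push Not at h; omega)
      have h2 := hdle i
      omega
    · by_contra h
      have h1 : Module.finrank E (𝔅.labelFilD ρ τ.toRingHom i) ≤
          Module.finrank E (𝔅.labelFilD ρ τ.toRingHom b) := hanti (by push Not at h; omega)
      omega
  have hcard : Multiset.card (𝔅.labelledHodgeTateWeights ρ τ.toRingHom) = 1 := by
    rw [𝔅.card_labelledHodgeTateWeights_eq_finrank ρ τ.toRingHom, hrank]
  obtain ⟨w, hw⟩ := Multiset.card_eq_one.1 hcard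
  rw [hw, Multiset.singleton_inj]
  have hjump : Module.finrank E (𝔅.labelFilD ρ τ.toRingHom (w + 1)) <
      Module.finrank E (𝔅.labelFilD ρ τ.toRingHom w) := by
    have hmem : w ∈ 𝔅.labelledHodgeTateWeights ρ τ.toRingHom := by
      rw [hw]; exact Multiset.mem_singleton_self w
    rw [PeriodRingData.labelledHodgeTateWeights_def] at hmem
    exact (mem_jumpMultiset_iff hfin w).1 hmem
  have hdw : Module.finrank E (𝔅.labelFilD ρ τ.toRingHom w) = 1 := by have := hdle w; omega
  have hdw' : Module.finrank E (𝔅.labelFilD ρ τ.toRingHom (w + 1)) = 0 := by have := hdle w; omega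
  have hFw : 𝔅.labelFilD ρ τ.toRingHom w = 𝔅.labelD ρ τ.toRingHom :=
    Submodule.eq_of_le_of_finrank_eq (𝔅.labelFilD_le ρ τ.toRingHom w) (by rw [hdw, hrank])
  have hFw' : 𝔅.labelFilD ρ τ.toRingHom (w + 1) = ⊥ :=
    (Submodule.eq_of_le_of_finrank_eq bot_le (by rw [finrank_bot, hdw'])).symm
  -- Step 2: a generator `x` of `D_τ`: `x ∈ (E ⊗ Fil^w) ∖ (E ⊗ Fil^{w+1})`
  have hne : 𝔅.labelD ρ τ.toRingHom ≠ ⊥ := by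
    intro h; rw [h, finrank_bot] at hrank; exact zero_ne_one hrank
  obtain ⟨x, hxD, hx0⟩ := Submodule.exists_mem_ne_zero_of_ne_bot hne
  have hxw : x ∈ 𝔅.coeffFilTensor E (Fin 1 → E) w :=
    𝔅.labelFilD_le_coeffFilTensor ρ τ.toRingHom w (by rw [hFw]; exact hxD)
  have hxw' : x ∉ 𝔅.coeffFilTensor E (Fin 1 → E) (w + 1) := by
    intro h
    have hmem : x ∈ 𝔅.labelFilD ρ τ.toRingHom (w + 1) := Submodule.mem_inf.2 ⟨hxD, h⟩
    rw [hFw', Submodule.mem_bot] at hmem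
    exact hx0 hmem
  -- Step 3: `z = ev_j x ∈ Fil^w ∖ Fil^{w+1}`, with `z = ι(j det rE σ) · σ z` on `Stab(j)`
  have hzw : evalEmb 𝔅 ιB j hιq x ∈ 𝔅.fil w :=
    (mem_coeffFilTensor_iff_forall_evalEmb_mem 𝔅 ιB hιq hιfil w x).1 hxw j
  have hzw' : evalEmb 𝔅 ιB j hιq x ∉ 𝔅.fil (w + 1) := by
    intro hz
    apply hxw'
    refine (mem_coeffFilTensor_iff_forall_evalEmb_mem 𝔅 ιB hιq hιfil (w + 1) x).2 fun j' => ?_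
    by_cases hj' : ∀ a : F, j' (τ a) = algebraMap F (AlgebraicClosure F) a
    · obtain ⟨σ, rfl⟩ := exists_absGalEmbComp_eq τ j j' hj hj'
      rw [evalEmb_absGalEmbComp 𝔅 ιB j hιq hισ rE (𝔅.labelD_le_coeffD ρ τ.toRingHom hxD) σ]
      refine 𝔅.smul_mem_fil σ (w + 1) _ ?_
      have h := 𝔅.mul_mem_fil 0 (w + 1) (ιB (j ((FramedRep.det rE σ : Eˣ) : E)))
        (evalEmb 𝔅 ιB j hιq x) (hιfil _) hz
      rwa [zero_add] at h
    · push Not at hj'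
      rw [evalEmb_eq_zero_of_mem_labelD 𝔅 ιB j' hιq hιa ρ τ hxD hj']
      exact zero_mem _
  have hzper : ∀ σ : absoluteGaloisGroup F, (∀ e : E, σ • j e = j e) →
      evalEmb 𝔅 ιB j hιq x = ιB (j ((FramedRep.det rE σ : Eˣ) : E)) * σ • evalEmb 𝔅 ιB j hιq x := by
    intro σ hσ
    have hcomp : absGalEmbComp σ j = j := AlgHom.ext fun e => by rw [absGalEmbComp_apply, hσ]
    have h := evalEmb_absGalEmbComp 𝔅 ιB j hιq hισ rE (𝔅.labelD_le_coeffD ρ τ.toRingHom hxD) σ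
    rw [hcomp, smul_mul', hισ, hσ] at h
    exact h
  -- Step 4: `θ`-reduction: a `ℂ_F`-period with exponent `w` on `Stab(j)`
  obtain ⟨y₁, hy₁0, hy₁⟩ := exists_theta_period_of_mem_fil_not_mem hp
    (Q := fun σ => ∀ e : E, σ • j e = j e)
    (φ := fun σ => j ((FramedRep.det rE σ : Eˣ) : E)) hzw hzw' hzper
  -- Step 5: compare with the given period on `Gal(F̄/M')`, `M' = M · F(j E)`
  obtain ⟨M', hM'fin, hM'⟩ := exists_intermediateField_fixing_embedding (p := p) M j
  haveI := hM'fin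
  by_contra hne
  have hχ0 : ∀ σ : absoluteGaloisGroup F, (algebraMap F (CompletedAlgClosure F)
      (LocalField.padicRingHom F p hp
        (((GaloisRep.cyclotomicCharacter F p σ : ℤ_[p]ˣ) : ℤ_[p]) : ℚ_[p]))) ≠ 0 := fun σ => by
    rw [map_ne_zero_iff _ (algebraMap F (CompletedAlgClosure F)).injective,
      map_ne_zero_iff _ (LocalField.padicRingHom F p hp).injective]
    exact PadicInt.coe_ne_zero.2 (GaloisRep.cyclotomicCharacter F p σ).ne_zero
  have hA0 : ∀ σ : absoluteGaloisGroup F, algClosureToC F (j ((FramedRep.det rE σ : Eˣ) : E)) ≠ 0 :=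
    fun σ => (map_ne_zero_iff _ (algClosureToC F).injective).2
      (by simpa using j.toRingHom.injective.ne (FramedRep.det rE σ).ne_zero)
  have key : ∀ σ : absoluteGaloisGroup F, (∀ m ∈ M', σ • m = m) →
      σ • (y * y₁⁻¹) = (algebraMap F (CompletedAlgClosure F)
        (LocalField.padicRingHom F p hp
          (((GaloisRep.cyclotomicCharacter F p σ : ℤ_[p]ˣ) : ℤ_[p]) : ℚ_[p]))) ^ (w - n) *
        (y * y₁⁻¹) := by
    intro σ hσ
    obtain ⟨hσM, hσj⟩ := hM' σ hσ
    have e1 := (eq_inv_mul_iff_mul_eq₀ (mul_ne_zero (hA0 σ) (zpow_ne_zero n (hχ0 σ)))).2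
      (hy σ hσM).symm
    have e2 := (eq_inv_mul_iff_mul_eq₀ (mul_ne_zero (hA0 σ) (zpow_ne_zero w (hχ0 σ)))).2
      (hy₁ σ hσj).symm
    rw [smul_mul', smul_inv'', e1, e2, zpow_sub₀ (hχ0 σ)]
    field_simp
    exact mul_div_mul_left _ _ (hA0 σ)
  have hzero := CompletedAlgClosure.eq_zero_of_forall_fixing_smul_eq_cyclotomicCharacter_zpow hp M'
    (j := w - n) (sub_ne_zero.2 hne) key
  exact mul_ne_zero hy0 (inv_ne_zero hy₁0) hzero

end BdR

end RankOneLabelledWeights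

end Literature.NumberTheory.PAdicHodge
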